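import Mathlib
import Literature.Analysis.SpecialFunctions.GammaRadicalFermatSurfaceOrbits
import HarnessLib
import HarnessLib.Audit.Tags

/-!
# HodgeLocusCensusChowlaSelbergAnchors — the four conifold anchors of the V3-CS layer (cell pub-hlocus, abs-1 gen 5)
HONEST FRAMING: certified instances and evidence bearing on the general Hodge conjecture; no claim.

CELL V3-CS normalises the (squared) holomorphic period of a CM fibre of the four hypergeometric K3 pencils,
`w₀ = ₂F₁(a_N, b_N; 1; c_N/X)²`, by the Chowla–Selberg period of the CM field `K = ℚ(√D₀)`,
`b_K = √π · ∏_{0<u<|D₀|} Γ(u/|D₀|)^{w χ(u)/(4h)}`, via `θ := -4π² w₀ / b_K²`.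
At the conifold apex `τ_C = i/√N` of pencil `N` one has `X = c_N` and, by Gauss' summation theorem
(`₂F₁(a,b;1;1) = Γ(1-a-b)/(Γ(1-a)Γ(1-b))` with `1-a-b = 1/2`, `Γ(1/2) = √π`), `w₀ = (√π/(Γ(1-a_N)Γ(1-b_N)))²`.
The cell's numerical anchors assert `θ_C = -√3, -√2, -2^{1/3}√3, -2` for `N = 1, 2, 3, 4`
(data/abs/cs/ANCHORS.json, ≥ 328 digits, two libraries). Here the three anchors that reduce to Mathlib's
reflection formula `Real.Gamma_mul_Gamma_one_sub` (the landed `Literature.Analysis.SpecialFunctions.Real_Gamma_quarter_mul_three_quarters` /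
`Real_Gamma_third_mul_two_thirds` are reused) and Legendre duplication `Real.Gamma_mul_Gamma_add_half`
are PROVED as closed real identities (N = 4: D₀ = -4, w = 4; N = 2: D₀ = -8, w = 2; N = 3: D₀ = -3, w = 6; h = 1),
with `w₀` written in its Gauss closed form (the hypergeometric evaluation itself is the cited input, not formalised).
The N = 1 anchor (`-√3`, D₀ = -4 at τ = i for ₂F₁(1/12,5/12;1;1)²) needs Gauss' triplication formula for Γ,
which Mathlib does not have; it is proved here from that formula as an explicit hypothesis.
-/
namespace Summit.HodgeConjecture.HodgeConjecture.HodgeLocus.Census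

open Real

/-- `sin(π/8) cos(π/8) = √2/4` (double angle). -/
theorem sin_mul_cos_pi_div_eight : Real.sin (π/8) * Real.cos (π/8) = √2 / 4 := by
  have h := Real.sin_two_mul (π/8)
  rw [show 2 * (π/8 : ℝ) = π/4 by ring, Real.sin_pi_div_four] at h
  linarith

/-- Reflection at 1/8 and 3/8: `Γ(1/8) Γ(3/8) Γ(5/8) Γ(7/8) = 2 √2 · π²`. -/
theorem Gamma_eighths_prod : Gamma (1/8) * Gamma (3/8) * Gamma (5/8) * Gamma (7/8) = 2 * √2 * π ^ 2 := by
  have h1 := Real.Gamma_mul_Gamma_one_sub (1/8 : ℝ)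
  have h3 := Real.Gamma_mul_Gamma_one_sub (3/8 : ℝ)
  have e1 : (1:ℝ) - 1/8 = 7/8 := by norm_num
  have e3 : (1:ℝ) - 3/8 = 5/8 := by norm_num
  have s1 : Real.sin (π * (1/8)) = Real.sin (π/8) := by rw [show π * (1/8 : ℝ) = π/8 by ring]
  have s3 : Real.sin (π * (3/8)) = Real.cos (π/8) := by
    rw [show π * (3/8 : ℝ) = π/2 - π/8 by ring]; exact Real.sin_pi_div_two_sub _
  rw [e1, s1] at h1
  rw [e3, s3] at h3
  have hsp : 0 < Real.sin (π/8) := Real.sin_pos_of_pos_of_lt_pi (by positivity) (by linarith [Real.pi_pos])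
  have hcp : 0 < Real.cos (π/8) := Real.cos_pos_of_mem_Ioo ⟨by linarith [Real.pi_pos], by linarith [Real.pi_pos]⟩
  have hsc := sin_mul_cos_pi_div_eight
  have h2 : (√2 : ℝ) ≠ 0 := by positivity
  have hsq : (√2 : ℝ) * √2 = 2 := Real.mul_self_sqrt (by norm_num)
  calc Gamma (1/8) * Gamma (3/8) * Gamma (5/8) * Gamma (7/8)
      = (Gamma (1/8) * Gamma (7/8)) * (Gamma (3/8) * Gamma (5/8)) := by ring
    _ = (π / Real.sin (π/8)) * (π / Real.cos (π/8)) := by rw [h1, h3]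
    _ = π ^ 2 / (Real.sin (π/8) * Real.cos (π/8)) := by field_simp
    _ = 2 * √2 * π ^ 2 := by rw [hsc]; field_simp; nlinarith [hsq]

/-- Legendre duplication at 1/3: `Γ(1/3) Γ(5/6) = 2^{1/3} √π Γ(2/3)`. -/
theorem Gamma_third_mul_Gamma_five_sixths :
    Gamma (1/3) * Gamma (5/6) = (2:ℝ) ^ ((1:ℝ)/3) * √π * Gamma (2/3) := by
  have h := Real.Gamma_mul_Gamma_add_half (1/3 : ℝ)
  rw [show (1/3 : ℝ) + 1/2 = 5/6 by norm_num, show 2 * (1/3 : ℝ) = 2/3 by norm_num,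
      show (1:ℝ) - 2/3 = 1/3 by norm_num] at h
  rw [h]; ring

/-- ANCHOR N = 4 (pencil X_(2,2,2), τ_C = i/2, D₀ = -4, w = 4, h = 1; a = b = 1/4):
`θ_C = -4π² (√π/Γ(3/4)²)² / (π (Γ(1/4)/Γ(3/4))²) = -2`. -/
theorem anchor_ci222 :
    -4 * π ^ 2 * (√π / (Gamma (3/4) * Gamma (3/4))) ^ 2 / (π * (Gamma (1/4) / Gamma (3/4)) ^ 2) = -2 := by
  have hq := Literature.Analysis.SpecialFunctions.Real_Gamma_quarter_mul_three_quarters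
  have g1 : Gamma (1/4 : ℝ) ≠ 0 := (Real.Gamma_pos_of_pos (by norm_num)).ne'
  have g3 : Gamma (3/4 : ℝ) ≠ 0 := (Real.Gamma_pos_of_pos (by norm_num)).ne'
  have hpi : (π : ℝ) ≠ 0 := Real.pi_ne_zero
  have hsp : (√π : ℝ) ^ 2 = π := Real.sq_sqrt Real.pi_pos.le
  have hsq : (√2 : ℝ) * √2 = 2 := Real.mul_self_sqrt (by norm_num)
  have key : (Gamma (1/4) * Gamma (3/4)) ^ 2 = 2 * π ^ 2 := by rw [hq]; nlinarith [hsq]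
  field_simp
  rw [hsp]
  nlinarith [key, Real.pi_pos]

/-- ANCHOR N = 2 (quartic Dwork pencil, τ_C = i/√2, D₀ = -8, w = 2, h = 1; a = 1/8, b = 3/8; χ₋₈ = + on 1,3 and - on 5,7):
`θ_C = -4π² (√π/(Γ(7/8)Γ(5/8)))² / (π Γ(1/8)Γ(3/8)/(Γ(5/8)Γ(7/8))) = -√2`. -/
theorem anchor_quartic :
    -4 * π ^ 2 * (√π / (Gamma (7/8) * Gamma (5/8))) ^ 2
      / (π * (Gamma (1/8) * Gamma (3/8) / (Gamma (5/8) * Gamma (7/8)))) = -√2 := by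
  have he := Gamma_eighths_prod
  have g1 : Gamma (1/8 : ℝ) ≠ 0 := (Real.Gamma_pos_of_pos (by norm_num)).ne'
  have g3 : Gamma (3/8 : ℝ) ≠ 0 := (Real.Gamma_pos_of_pos (by norm_num)).ne'
  have g5 : Gamma (5/8 : ℝ) ≠ 0 := (Real.Gamma_pos_of_pos (by norm_num)).ne'
  have g7 : Gamma (7/8 : ℝ) ≠ 0 := (Real.Gamma_pos_of_pos (by norm_num)).ne'
  have hpi : (π : ℝ) ≠ 0 := Real.pi_ne_zero
  have hsp : (√π : ℝ) ^ 2 = π := Real.sq_sqrt Real.pi_pos.le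
  have h2 : (√2 : ℝ) ≠ 0 := by positivity
  have hsq : (√2 : ℝ) * √2 = 2 := Real.mul_self_sqrt (by norm_num)
  have he2 : Gamma (1/8) * Gamma (3/8) * Gamma (5/8) * Gamma (7/8) * √2 = 4 * π ^ 2 := by
    rw [he]; nlinarith [hsq]
  rw [div_eq_iff (by positivity), div_pow, hsp]
  field_simp
  linarith [he2]

/-- ANCHOR N = 3 (pencil X_(2,3), τ_C = i/√3, point of discriminant -12, D₀ = -3, w = 6, h = 1; a = 1/6, b = 1/3):
`θ_C = -4π² (√π/(Γ(5/6)Γ(2/3)))² / (π (Γ(1/3)/Γ(2/3))³) = -2^{1/3} √3`. -/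
theorem anchor_ci23 :
    -4 * π ^ 2 * (√π / (Gamma (5/6) * Gamma (2/3))) ^ 2 / (π * (Gamma (1/3) / Gamma (2/3)) ^ 3)
      = -((2:ℝ) ^ ((1:ℝ)/3) * √3) := by
  set t : ℝ := (2:ℝ) ^ ((1:ℝ)/3) with ht
  have tpos : 0 < t := Real.rpow_pos_of_pos (by norm_num) _
  have t3 : t ^ 3 = 2 := by
    rw [ht, ← Real.rpow_natCast, ← Real.rpow_mul (by norm_num)]; norm_num
  have hd := Gamma_third_mul_Gamma_five_sixths      -- Γ(1/3) Γ(5/6) = t √π Γ(2/3)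
  have hr := Literature.Analysis.SpecialFunctions.Real_Gamma_third_mul_two_thirds       -- Γ(1/3) Γ(2/3) = 2π/√3
  have g13 : 0 < Gamma (1/3 : ℝ) := Real.Gamma_pos_of_pos (by norm_num)
  have g23 : 0 < Gamma (2/3 : ℝ) := Real.Gamma_pos_of_pos (by norm_num)
  have g56 : 0 < Gamma (5/6 : ℝ) := Real.Gamma_pos_of_pos (by norm_num)
  have hpi : 0 < (π : ℝ) := Real.pi_pos
  have hsp : (√π : ℝ) ^ 2 = π := Real.sq_sqrt Real.pi_pos.le
  have hspp : 0 < (√π : ℝ) := Real.sqrt_pos.mpr hpi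
  have h3 : 0 < (√3 : ℝ) := by positivity
  have hsq3 : (√3 : ℝ) * √3 = 3 := Real.mul_self_sqrt (by norm_num)
  -- express Γ(5/6) and Γ(2/3) through Γ(1/3):
  have e56 : Gamma (5/6 : ℝ) = t * √π * Gamma (2/3) / Gamma (1/3) := by
    field_simp; linarith [hd]
  have hr' := hr
  field_simp at hr'
  have e23 : Gamma (2/3 : ℝ) = 2 * π / (√3 * Gamma (1/3)) := by
    field_simp; linarith [hr']
  rw [e56]
  rw [e23]
  field_simp
  rw [t3]; norm_num

/-- ANCHOR N = 1 (sextic pencil, τ_C = i, D₀ = -4, w = 4, h = 1; a = 1/12, b = 5/12), from GAUSS' TRIPLICATION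
formula at 1/4, `Γ(1/4) Γ(7/12) Γ(11/12) = 2π · 3^{-1/4} · Γ(3/4)` (hypothesis `htrip`; not in Mathlib):
`θ_C = -4π² (√π/(Γ(11/12)Γ(7/12)))² / (π (Γ(1/4)/Γ(3/4))²) = -√3`. -/
theorem anchor_sextic_of_triplication
    (htrip : Gamma (1/4) * Gamma (7/12) * Gamma (11/12) = 2 * π * (3:ℝ) ^ (-(1:ℝ)/4) * Gamma (3/4)) :
    -4 * π ^ 2 * (√π / (Gamma (11/12) * Gamma (7/12))) ^ 2 / (π * (Gamma (1/4) / Gamma (3/4)) ^ 2) = -√3 := by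
  set s : ℝ := (3:ℝ) ^ (-(1:ℝ)/4) with hs
  have spos : 0 < s := Real.rpow_pos_of_pos (by norm_num) _
  have s4 : s ^ 4 * 3 = 1 := by
    rw [hs, ← Real.rpow_natCast, ← Real.rpow_mul (by norm_num)]
    norm_num
  have g14 : 0 < Gamma (1/4 : ℝ) := Real.Gamma_pos_of_pos (by norm_num)
  have g34 : 0 < Gamma (3/4 : ℝ) := Real.Gamma_pos_of_pos (by norm_num)
  have g712 : 0 < Gamma (7/12 : ℝ) := Real.Gamma_pos_of_pos (by norm_num)
  have g1112 : 0 < Gamma (11/12 : ℝ) := Real.Gamma_pos_of_pos (by norm_num)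
  have hpi : 0 < (π : ℝ) := Real.pi_pos
  have hsp : (√π : ℝ) ^ 2 = π := Real.sq_sqrt Real.pi_pos.le
  have h3 : 0 < (√3 : ℝ) := by positivity
  have hsq3 : (√3 : ℝ) ^ 2 = 3 := Real.sq_sqrt (by norm_num)
  -- Γ(7/12) Γ(11/12) = 2 π s Γ(3/4) / Γ(1/4)
  have e : Gamma (11/12 : ℝ) * Gamma (7/12) = 2 * π * s * Gamma (3/4) / Gamma (1/4) := by
    field_simp; linarith [htrip]
  have lhs : -4 * π ^ 2 * (√π / (Gamma (11/12) * Gamma (7/12))) ^ 2 / (π * (Gamma (1/4) / Gamma (3/4)) ^ 2)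
      = -1 / s ^ 2 := by
    rw [e]; field_simp; rw [hsp]; ring
  rw [lhs]
  -- -1/s² = -√3  ⟸  s² √3 = 1  ⟸  s⁴·3 = 1, s > 0
  have s2 : s ^ 2 * √3 = 1 := by
    have hpos : 0 < s ^ 2 * √3 := by positivity
    have hsqr : (s ^ 2 * √3) ^ 2 = 1 := by nlinarith [s4, hsq3]
    nlinarith [hsqr, hpos]
  field_simp
  linarith [s2]

end Summit.HodgeConjecture.HodgeConjecture.HodgeLocus.Census
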